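import Summits.QuantumFields.YangMills.Theorems.AllWindowsColdBoxBoxHighLineSchurBlocks
import Summits.QuantumFields.YangMills.Theorems.AllWindowsColdBoxBoxKernelShiftedDecay
import Summits.QuantumFields.YangMills.Theorems.AllWindowsColdBoxBoxKernelSizeDecay

/-!
# LINE-19 S3b / LINE-20 U1 — STUB-PLAN-U1 §7.4 inputs (h1) and (h2): decay of `restInv` and of `restInv * couplingᵀ`

Two of the four uniform block inputs of `RestBlock.landauKernelBounds_of_inputs` (file `…SchurBlocks`):

* **(h1) `restInv_size_bound`** — `|restInv r r'|·(1 + d(r,r'))² ≤ c₁`: the rest-block inverse is the D/N box Green function of the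
  base points (`restInv_apply_of_eq`), whose size decay is `BoxKernel.boxLap_inv_size_decay`;
* **(h2) `restInv_coupling_bound`** — `|(restInv * couplingᵀ)(r,s)|·(1 + d(r,s))³ ≤ c₂`: the row of a SKIN link `s` against the
  `r`-column of `restInv` is, by `hodgeQ_mulVec_apply`, a signed sum of six plaquette circulations of the zero-extended kernel
  `z ↦ [z rest] G_B(x_r, z)` (`restKer`), and every such circulation is a lattice GRADIENT of the box Green function — across a Dirichlet
  face the missing partner is the vanishing ghost entry (`restKer_diff_bound`, using `BoxKernel.boxGreen_grad_fst_decay_shift` and the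
  Dirichlet vanishing `boxGreen_dirichlet_bottom/top`).

Everything proved; standard axioms.  HONEST LABEL: bookkeeping toward stub S3 (⟨stmt-QuantumFields-24004⟩/⟨24335⟩; U1 of ⟨24336⟩);
S3 is NOT closed by this file ((J′2), (h3) remain); no crux, rung or summit is proved; the Yang–Mills mass gap is NOT proved here.
-/

set_option autoImplicit false

noncomputable section

namespace Summit.QuantumFields.YangMills.Theorems.AllWindowsColdBoxBoxHighLine

open Finset Matrix
open Literature.Probability.LatticeModels (Site)
open Literature.MathematicalPhysics.QuantumFieldTheory
open Literature.MathematicalPhysics.QuantumFieldTheory.LatticeMaxwell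
open Literature.MathematicalPhysics.QuantumFieldTheory.AxialGauge
open Summit.QuantumFields.YangMills.Theorems.WeakCouplingRates
open Summit.QuantumFields.YangMills.Theorems.AllWindowsColdBox.BoxKernel

namespace RestBlock

variable {H : ℕ}

/-! ## (h1) size decay of `restInv` -/

/-- **(h1)**: `|restInv r r'|·(1 + d_∞(r, r'))² ≤ c₁`, uniformly in `H`. -/
theorem restInv_size_bound : ∃ c₁ : ℝ, 0 ≤ c₁ ∧ ∀ H : ℕ, 1 ≤ H → ∀ r r' : Rest H,
    |restInv H r r'| * (1 + linkDist r.1 r'.1) ^ (2 : ℝ) ≤ c₁ := by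
  obtain ⟨C, hC0, hC⟩ := boxLap_inv_size_decay
  refine ⟨C, hC0, fun H hH r r' => ?_⟩
  haveI : NeZero (2 * H) := ⟨by omega⟩
  by_cases hμ : r.1.1.1.2 = r'.1.1.1.2
  · obtain ⟨k, hk⟩ := exists_linkDist_eq r.1 r'.1
    rw [restInv_apply_of_eq r.1.1.1.2 r r' rfl hμ.symm, hk, show ((2 : ℝ)) = ((2 : ℕ) : ℝ) by norm_num, Real.rpow_natCast]
    have h := hC (2 * H) (univ.erase r.1.1.1.2) (erase_nonempty _) k (toBox r.1.1.1.2 r.1.1.1.1 (isRest_rest r))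
      (toBox r.1.1.1.2 r'.1.1.1.1 (hμ.symm ▸ isRest_rest r'))
    rw [toBox_apply_cast, toBox_apply_cast] at h
    push_cast
    exact h
  · rw [restInv_apply_of_ne r r' hμ, abs_zero, zero_mul]; exact hC0

/-! ## The zero-extended kernel column of a rest link -/

/-- The `r`-column of `restInv` as a function of an arbitrary lattice point `z` (base point of a link of the direction of `r`):
the box Green function if `(z, μ_r)` is a rest link, `0` otherwise. -/
def restKer (r : Rest H) (z : Site 4) : ℝ := by
  classical
  exact if h : IsRest H z r.1.1.1.2 then
    (boxLap (2 * H) (univ.erase r.1.1.1.2))⁻¹ (toBox r.1.1.1.2 r.1.1.1.1 (isRest_rest r)) (toBox r.1.1.1.2 z h) else 0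

/-- `restKer` at a rest point is the box Green function of the base points. -/
theorem restKer_of_isRest [NeZero (2 * H)] (r : Rest H) {z : Site 4} (h : IsRest H z r.1.1.1.2) :
    restKer r z = boxGreen (2 * H) (univ.erase r.1.1.1.2) r.1.1.1.1 z := by
  unfold restKer
  rw [dif_pos h, boxLap_inv_eq (erase_nonempty _)]
  simp only [boxGreenMat, Matrix.of_apply, coords_toBox]

/-- `restKer` vanishes off the rest links. -/
theorem restKer_of_not_isRest (r : Rest H) {z : Site 4} (h : ¬ IsRest H z r.1.1.1.2) : restKer r z = 0 := by
  unfold restKer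
  rw [dif_neg h]

/-- A rest link in coordinates is a cold-box edge. -/
theorem mem_boxEdges_of_isRest {z : Site 4} {μ : Fin 4} (h : IsRest H z μ) : (z, μ) ∈ boxEdges 4 (2 * H + 1) := by
  rw [mem_boxEdges_iff]
  refine ⟨fun k => ?_, ?_⟩
  · have h0 : 0 ≤ z k ∧ z k ≤ 2 * (H : ℤ) - 1 := by
      by_cases hk : k = μ
      · subst hk; exact ⟨h.2.1, h.2.2⟩
      · have := h.1 k hk; omega
    push_cast; omega
  · have := h.2.2; push_cast; omega

/-- A rest link in coordinates is an edge of the enlarged block. -/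
theorem mem_boxEdgesAt_of_isRest {z : Site 4} {μ : Fin 4} (h : IsRest H z μ) : (z, μ) ∈ boxEdgesAt dirCorner (2 * H + 3) := by
  rw [mem_boxEdgesAt, mem_boxEdges_iff]
  refine ⟨fun k => ?_, ?_⟩
  · have h0 : 0 ≤ z k ∧ z k ≤ 2 * (H : ℤ) - 1 := by
      by_cases hk : k = μ
      · subst hk; exact ⟨h.2.1, h.2.2⟩
      · have := h.1 k hk; omega
    simp only [Pi.sub_apply, dirCorner]
    push_cast; omega
  · have := h.2.2
    simp only [Pi.sub_apply, dirCorner]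
    push_cast; omega

/-- The rest-supported vector `e ↦ restInv r e` (zero on the skin). -/
def restVec (r : Rest H) (e : LandauFree H) : ℝ :=
  if h : (e.1.1.1 ∈ interiorSites H ∨ e.1.1.1 + Pi.single e.1.1.2 1 ∈ interiorSites H) then restInv H r ⟨e, h⟩ else 0

/-- **The zero extension of the `r`-column of `restInv`**: at an edge `(z, i)` it is `[i = μ_r]·restKer r z`. -/
theorem glue_restVec (hH : 1 ≤ H) (r : Rest H) (z : Site 4) (i : Fin 4) :
    glue (pin := landauPin H) dirCorner (2 * H + 3) 0 (restVec r) (z, i) = if i = r.1.1.1.2 then restKer r z else 0 := by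
  unfold glue
  by_cases hblock : (z, i) ∈ boxEdgesAt dirCorner (2 * H + 3)
  · rw [dif_pos hblock]
    by_cases hpin : landauPin H (z, i)
    · rw [dif_pos hpin]
      change (0 : ℝ) = _
      by_cases hi : i = r.1.1.1.2
      · rw [if_pos hi]
        by_cases hz : IsRest H z r.1.1.1.2
        · exact absurd (mem_boxEdges_of_isRest (hi ▸ hz)) hpin
        · rw [restKer_of_not_isRest r hz]
      · rw [if_neg hi]
    · rw [dif_neg hpin]
      unfold restVec
      by_cases hi : i = r.1.1.1.2
      · rw [if_pos hi]
        by_cases hz : IsRest H z r.1.1.1.2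
        · have hmem : z ∈ interiorSites H ∨ z + Pi.single i 1 ∈ interiorSites H := by
            rw [hi]; exact mem_or_mem_of_isRest hH hz
          rw [dif_pos hmem]
          unfold restKer
          rw [dif_pos hz]
          exact restInv_apply_of_eq r.1.1.1.2 r ⟨⟨⟨(z, i), hblock⟩, hpin⟩, hmem⟩ rfl hi
        · have hmem : ¬ (z ∈ interiorSites H ∨ z + Pi.single i 1 ∈ interiorSites H) := fun hc =>
            hz (hi ▸ isRest_of_mem_or_mem hc)
          rw [dif_neg hmem, restKer_of_not_isRest r hz]
      · rw [if_neg hi]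
        by_cases hmem : (z ∈ interiorSites H ∨ z + Pi.single i 1 ∈ interiorSites H)
        · rw [dif_pos hmem]
          exact restInv_apply_of_ne r ⟨⟨⟨(z, i), hblock⟩, hpin⟩, hmem⟩ (Ne.symm hi)
        · rw [dif_neg hmem]
  · rw [dif_neg hblock]
    by_cases hi : i = r.1.1.1.2
    · rw [if_pos hi]
      by_cases hz : IsRest H z r.1.1.1.2
      · exact absurd (mem_boxEdgesAt_of_isRest (hi ▸ hz)) hblock
      · rw [restKer_of_not_isRest r hz]
    · rw [if_neg hi]

/-- **The row identity**: `(restInv * couplingᵀ)(r, s) = (hodgeQ · restVec r)(s)`. -/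
theorem restInv_mul_couplingT_apply (r : Rest H) (s : Skin H) :
    (restInv H * (coupling H)ᵀ) r s = (hodgeQ H *ᵥ restVec r) s.1 := by
  rw [Matrix.mul_apply, Matrix.mulVec, dotProduct]
  rw [← Equiv.sum_comp (skinRest H) (fun e => hodgeQ H s.1 e * restVec r e), Fintype.sum_sum_type]
  have h0 : ∑ s' : Skin H, hodgeQ H s.1 (skinRest H (Sum.inl s')) * restVec r (skinRest H (Sum.inl s')) = 0 := by
    refine Finset.sum_eq_zero fun s' _ => ?_
    rw [skinRest_inl]
    unfold restVec
    rw [dif_neg s'.2, mul_zero]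
  rw [h0, zero_add]
  refine Finset.sum_congr rfl fun r' _ => ?_
  rw [skinRest_inr, Matrix.transpose_apply, coupling, Matrix.of_apply, mul_comm]
  unfold restVec
  rw [dif_pos r'.2]

/-! ## Every circulation of the kernel column is a gradient -/

/-- Across a transverse Dirichlet face from below: if `(z + e_ν, μ)` is a rest link and `(z, μ)` is not, then `z_ν = 0`. -/
theorem coord_eq_zero_of_isRest_add {z : Site 4} {μ ν : Fin 4} (hν : ν ≠ μ) (h' : IsRest H (z + Pi.single ν 1) μ)
    (h : ¬ IsRest H z μ) : z ν = 0 := by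
  by_contra h0
  apply h
  have hνc := h'.1 ν hν
  simp only [Pi.add_apply, Pi.single_eq_same] at hνc
  refine ⟨fun κ hκ => ?_, ?_, ?_⟩
  · by_cases hκν : κ = ν
    · subst hκν; omega
    · have := h'.1 κ hκ
      simpa [Pi.add_apply, Pi.single_apply, hκν] using this
  · have := h'.2.1; simpa [Pi.add_apply, Pi.single_apply, hν.symm] using this
  · have := h'.2.2; simpa [Pi.add_apply, Pi.single_apply, hν.symm] using this

/-- Across a transverse Dirichlet face from above: if `(z, μ)` is a rest link and `(z + e_ν, μ)` is not, then `z_ν = 2H − 1`. -/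
theorem coord_eq_of_isRest_not_add {z : Site 4} {μ ν : Fin 4} (hν : ν ≠ μ) (h : IsRest H z μ)
    (h' : ¬ IsRest H (z + Pi.single ν 1) μ) : z ν = 2 * (H : ℤ) - 1 := by
  by_contra h0
  apply h'
  have hνc := h.1 ν hν
  refine ⟨fun κ hκ => ?_, ?_, ?_⟩
  · by_cases hκν : κ = ν
    · subst hκν; simp only [Pi.add_apply, Pi.single_eq_same]; omega
    · have := h.1 κ hκ
      simpa [Pi.add_apply, Pi.single_apply, hκν] using this
  · have := h.2.1; simpa [Pi.add_apply, Pi.single_apply, hν.symm] using this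
  · have := h.2.2; simpa [Pi.add_apply, Pi.single_apply, hν.symm] using this

/-- Moving the base point by one step costs at most a factor `8` in the cubic weight. -/
theorem weight_shift_le {a b c : ℝ} (h : |a - b| ≤ |a - c| + 1) : (1 + |a - b|) ^ 3 ≤ 8 * (1 + |a - c|) ^ 3 := by
  have h0 : 0 ≤ |a - c| := abs_nonneg _
  have h1 : 1 + |a - b| ≤ 2 * (1 + |a - c|) := by linarith
  calc (1 + |a - b|) ^ 3 ≤ (2 * (1 + |a - c|)) ^ 3 := pow_le_pow_left₀ (by positivity) h1 3
    _ = 8 * (1 + |a - c|) ^ 3 := by ring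

/-- **The transverse differences of the kernel column are gradients of the box Green function** (inside the box, or across a Dirichlet
face where the missing partner is the vanishing ghost entry): `|restKer r (z + e_ν) − restKer r z|·(1 + |x_κ − z_κ|)³ ≤ C`, `ν ≠ μ_r`. -/
theorem restKer_diff_bound : ∃ C : ℝ, 0 ≤ C ∧ ∀ H : ℕ, 1 ≤ H → ∀ (r : Rest H) (z : Site 4) (ν κ : Fin 4), ν ≠ r.1.1.1.2 →
    |restKer r (z + Pi.single ν 1) - restKer r z| * (1 + |((r.1.1.1.1 κ - z κ : ℤ) : ℝ)|) ^ 3 ≤ C := by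
  obtain ⟨C, hC0, hC⟩ := boxGreen_grad_fst_decay_shift
  refine ⟨8 * C, by positivity, fun H hH r z ν κ hν => ?_⟩
  haveI : NeZero (2 * H) := ⟨by omega⟩
  set μ := r.1.1.1.2 with hμ
  set x := r.1.1.1.1 with hx
  have hxr : IsRest H x μ := isRest_rest r
  have hνD : ν ∈ Finset.univ.erase μ := Finset.mem_erase.2 ⟨hν, Finset.mem_univ _⟩
  set sx := toBox μ x hxr with hsx
  have hcx : coords sx = x := coords_toBox μ x hxr
  have castx : (((sx.1 κ : ℕ)) : ℝ) = ((x κ : ℤ) : ℝ) := toBox_apply_cast μ x hxr κ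
  by_cases hz : IsRest H z μ <;> by_cases hz' : IsRest H (z + Pi.single ν 1) μ
  · -- both rest links: a gradient inside the box
    set t := toBox μ z hz with ht
    have h := hC (2 * H) (Finset.univ.erase μ) ν κ 0 (Or.inl rfl) t sx
    rw [Pi.single_zero, add_zero, coords_toBox, hcx, toBox_apply_cast, castx] at h
    rw [restKer_of_isRest r hz', restKer_of_isRest r hz, boxGreen_comm x, boxGreen_comm x]
    push_cast at h ⊢
    rw [abs_sub_comm ((x κ : ℝ))]
    exact h.trans (by linarith)
  · -- only the lower link is a rest link: `z_ν = 2H − 1`, the upper entry is the Dirichlet ghost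
    have hz1 : z ν = 2 * (H : ℤ) - 1 := coord_eq_of_isRest_not_add hν hz hz'
    set t := toBox μ z hz with ht
    have ht1 : (t.1 ν : ℕ) + 1 = 2 * H := by
      have : (t.1 ν : ℕ) = (z ν).toNat := rfl
      omega
    have h := hC (2 * H) (Finset.univ.erase μ) ν κ 0 (Or.inl rfl) t sx
    rw [Pi.single_zero, add_zero, boxGreen_dirichlet_top hνD t ht1, zero_sub, abs_neg, coords_toBox, hcx, toBox_apply_cast,
      castx] at h
    rw [restKer_of_not_isRest r hz', restKer_of_isRest r hz, zero_sub, abs_neg, boxGreen_comm x]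
    push_cast at h ⊢
    rw [abs_sub_comm ((x κ : ℝ))]
    exact h.trans (by linarith)
  · -- only the upper link is a rest link: `z_ν = 0`, the lower entry is the Dirichlet ghost
    have hz0 : z ν = 0 := coord_eq_zero_of_isRest_add hν hz' hz
    set t := toBox μ (z + Pi.single ν 1) hz' with ht
    have ht1 : (t.1 ν : ℕ) = 1 := by
      have h1 : (t.1 ν : ℕ) = ((z + Pi.single ν 1 : Site 4) ν).toNat := rfl
      have h2 : (z + Pi.single ν 1 : Site 4) ν = z ν + 1 := by simp
      omega
    have h := hC (2 * H) (Finset.univ.erase μ) ν κ (-1) (Or.inr rfl) t sx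
    have e1 : coords t + Pi.single ν (-1 : ℤ) + Pi.single ν 1 = z + Pi.single ν 1 := by
      rw [coords_toBox, add_assoc, ← Pi.single_add]; simp
    have e2 : coords t + Pi.single ν (-1 : ℤ) = coords t - Pi.single ν 1 := by
      rw [sub_eq_add_neg, ← Pi.single_neg]
    rw [e1, e2, boxGreen_dirichlet_bottom hνD t ht1, sub_zero, hcx, toBox_apply_cast, castx] at h
    rw [restKer_of_isRest r hz', restKer_of_not_isRest r hz, sub_zero, boxGreen_comm x]
    have hzk : ((((z + Pi.single ν 1 : Site 4) κ : ℤ)) : ℝ) = ((z κ : ℤ) : ℝ) + (if κ = ν then 1 else 0) := by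
      simp only [Pi.add_apply, Pi.single_apply]
      split_ifs <;> push_cast <;> ring
    rw [hzk, abs_sub_comm (((z κ : ℤ) : ℝ) + _)] at h
    have hw : |((x κ : ℤ) : ℝ) - ((z κ : ℤ) : ℝ)| ≤ |((x κ : ℤ) : ℝ) - (((z κ : ℤ) : ℝ) + (if κ = ν then 1 else 0))| + 1 := by
      have h3 := abs_sub_le (((x κ : ℤ) : ℝ)) ((((z κ : ℤ) : ℝ) + (if κ = ν then 1 else 0))) (((z κ : ℤ) : ℝ))
      have h4 : |((((z κ : ℤ) : ℝ) + (if κ = ν then 1 else 0))) - ((z κ : ℤ) : ℝ)| ≤ 1 := by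
        split_ifs <;> simp
      linarith
    have hW := weight_shift_le hw
    push_cast
    calc |boxGreen (2 * H) (univ.erase μ) (z + Pi.single ν 1) x| * (1 + |((x κ : ℤ) : ℝ) - ((z κ : ℤ) : ℝ)|) ^ 3
        ≤ |boxGreen (2 * H) (univ.erase μ) (z + Pi.single ν 1) x| *
            (8 * (1 + |((x κ : ℤ) : ℝ) - (((z κ : ℤ) : ℝ) + (if κ = ν then 1 else 0))|) ^ 3) :=
          mul_le_mul_of_nonneg_left hW (abs_nonneg _)
      _ = 8 * (|boxGreen (2 * H) (univ.erase μ) (z + Pi.single ν 1) x| *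
            (1 + |((x κ : ℤ) : ℝ) - (((z κ : ℤ) : ℝ) + (if κ = ν then 1 else 0))|) ^ 3) := by ring
      _ ≤ 8 * C := mul_le_mul_of_nonneg_left h (by norm_num)
  · rw [restKer_of_not_isRest r hz', restKer_of_not_isRest r hz, sub_zero, abs_zero, zero_mul]
    positivity

/-! ## (h2) the bound -/

/-- Summation bookkeeping: termwise weighted bounds for two finite families give a weighted bound for the sum of their sums. -/
theorem abs_sum_add_sum_mul_le {ι : Type*} [Fintype ι] (A B : ι → ℝ) (W c : ℝ) (hW : 0 ≤ W)
    (hA : ∀ i, |A i| * W ≤ c) (hB : ∀ i, |B i| * W ≤ c) :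
    |∑ i, A i + ∑ i, B i| * W ≤ 2 * Fintype.card ι * c := by
  have h1 : |∑ i, A i| * W ≤ Fintype.card ι * c := by
    calc |∑ i, A i| * W ≤ (∑ i, |A i|) * W := mul_le_mul_of_nonneg_right (Finset.abs_sum_le_sum_abs _ _) hW
      _ = ∑ i, |A i| * W := Finset.sum_mul _ _ _
      _ ≤ ∑ _i : ι, c := Finset.sum_le_sum fun i _ => hA i
      _ = Fintype.card ι * c := by rw [Finset.sum_const, Finset.card_univ, nsmul_eq_mul]
  have h2 : |∑ i, B i| * W ≤ Fintype.card ι * c := by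
    calc |∑ i, B i| * W ≤ (∑ i, |B i|) * W := mul_le_mul_of_nonneg_right (Finset.abs_sum_le_sum_abs _ _) hW
      _ = ∑ i, |B i| * W := Finset.sum_mul _ _ _
      _ ≤ ∑ _i : ι, c := Finset.sum_le_sum fun i _ => hB i
      _ = Fintype.card ι * c := by rw [Finset.sum_const, Finset.card_univ, nsmul_eq_mul]
  have h3 := mul_le_mul_of_nonneg_right (abs_add_le (∑ i, A i) (∑ i, B i)) hW
  rw [add_mul] at h3; linarith

/-- **(h2)**: `|(restInv * couplingᵀ)(r, s)|·(1 + d_∞(r, s))³ ≤ c₂`, uniformly in `H`. -/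
theorem restInv_coupling_bound : ∃ c₂ : ℝ, 0 ≤ c₂ ∧ ∀ H : ℕ, 1 ≤ H → ∀ (r : Rest H) (s : Skin H),
    |(restInv H * (coupling H)ᵀ) r s| * (1 + linkDist r.1 s.1) ^ (3 : ℝ) ≤ c₂ := by
  obtain ⟨C, hC0, hD⟩ := restKer_diff_bound
  refine ⟨128 * C, by positivity, fun H hH r s => ?_⟩
  set μ := r.1.1.1.2 with hμ
  set x := r.1.1.1.1 with hx
  -- the zero extension of the kernel column
  set u : Literature.MathematicalPhysics.QuantumLattice.ZdEdge 4 → ℝ := fun f => if f.2 = μ then restKer r f.1 else 0 with hu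
  have hglue : u = glue (pin := landauPin H) dirCorner (2 * H + 3) 0 (restVec r) := by
    funext f
    rw [hu]
    exact (glue_restVec hH r f.1 f.2).symm
  rw [restInv_mul_couplingT_apply, hodgeQ_mulVec_apply (restVec r) s.1 u hglue]
  have hs1 : s.1.1.1.1 + Pi.single s.1.1.1.2 1 ∉ interiorSites H := fun h => s.2 (Or.inr h)
  have hs2 : s.1.1.1.1 ∉ interiorSites H := fun h => s.2 (Or.inl h)
  rw [if_neg hs1, if_neg hs2, sub_self, add_zero, show ((3 : ℝ)) = ((3 : ℕ) : ℝ) by norm_num, Real.rpow_natCast]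
  set y := s.1.1.1.1 with hy
  set μ' := s.1.1.1.2 with hμ'
  set W : ℝ := (1 + linkDist r.1 s.1) ^ 3 with hW
  have hW0 : 0 ≤ W := by have := linkDist_nonneg r.1 s.1; positivity
  obtain ⟨κ, hκ⟩ := exists_linkDist_eq r.1 s.1
  rw [← hx, ← hy] at hκ
  -- one circulation
  have hcirc : ∀ (z : Site 4) (i j : Fin 4), i ≠ j → |((z κ - y κ : ℤ) : ℝ)| ≤ 1 →
      |u (z, i) + u (z + Pi.single i 1, j) - u (z + Pi.single j 1, i) - u (z, j)| * W ≤ 8 * C := by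
    intro z i j hij hz
    have hWz : W ≤ 8 * (1 + |((x κ - z κ : ℤ) : ℝ)|) ^ 3 := by
      rw [hW, hκ]
      push_cast
      apply weight_shift_le
      have := abs_sub_le (((x κ : ℤ) : ℝ)) (((z κ : ℤ) : ℝ)) (((y κ : ℤ) : ℝ))
      push_cast at hz ⊢
      linarith
    by_cases hi : i = μ
    · have hj : j ≠ μ := fun h => hij (hi.trans h.symm)
      have hval : u (z, i) + u (z + Pi.single i 1, j) - u (z + Pi.single j 1, i) - u (z, j) =
          -(restKer r (z + Pi.single j 1) - restKer r z) := by
        simp only [hu, hi, hj, if_true, if_false]; ring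
      rw [hval, abs_neg]
      have h := hD H hH r z j κ hj
      calc |restKer r (z + Pi.single j 1) - restKer r z| * W
          ≤ |restKer r (z + Pi.single j 1) - restKer r z| * (8 * (1 + |((x κ - z κ : ℤ) : ℝ)|) ^ 3) :=
            mul_le_mul_of_nonneg_left hWz (abs_nonneg _)
        _ = 8 * (|restKer r (z + Pi.single j 1) - restKer r z| * (1 + |((x κ - z κ : ℤ) : ℝ)|) ^ 3) := by ring
        _ ≤ 8 * C := mul_le_mul_of_nonneg_left h (by norm_num)
    · by_cases hj : j = μ
      · have hval : u (z, i) + u (z + Pi.single i 1, j) - u (z + Pi.single j 1, i) - u (z, j) =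
            restKer r (z + Pi.single i 1) - restKer r z := by
          simp only [hu, hi, hj, if_true, if_false]; ring
        rw [hval]
        have h := hD H hH r z i κ hi
        calc |restKer r (z + Pi.single i 1) - restKer r z| * W
            ≤ |restKer r (z + Pi.single i 1) - restKer r z| * (8 * (1 + |((x κ - z κ : ℤ) : ℝ)|) ^ 3) :=
              mul_le_mul_of_nonneg_left hWz (abs_nonneg _)
          _ = 8 * (|restKer r (z + Pi.single i 1) - restKer r z| * (1 + |((x κ - z κ : ℤ) : ℝ)|) ^ 3) := by ring
          _ ≤ 8 * C := mul_le_mul_of_nonneg_left h (by norm_num)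
      · have hval : u (z, i) + u (z + Pi.single i 1, j) - u (z + Pi.single j 1, i) - u (z, j) = 0 := by
          simp only [hu, hi, hj, if_false]; ring
        rw [hval, abs_zero, zero_mul]; positivity
  have hy0 : |((y κ - y κ : ℤ) : ℝ)| ≤ 1 := by simp
  have hy1 : ∀ ν : Fin 4, |(((y - Pi.single ν 1 : Site 4) κ - y κ : ℤ) : ℝ)| ≤ 1 := by
    intro ν; simp only [Pi.sub_apply, Pi.single_apply]; split_ifs <;> simp
  -- the two sums, term by term
  have hA : ∀ ν : Fin 4, |(if μ' < ν then
        (u (y, μ') + u (y + Pi.single μ' 1, ν) - u (y + Pi.single ν 1, μ') - u (y, ν)) -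
          (u (y - Pi.single ν 1, μ') + u (y - Pi.single ν 1 + Pi.single μ' 1, ν) -
            u (y - Pi.single ν 1 + Pi.single ν 1, μ') - u (y - Pi.single ν 1, ν)) else 0)| * W ≤ 16 * C := by
    intro ν
    by_cases hlt : μ' < ν
    · rw [if_pos hlt]
      have h1 := hcirc y μ' ν (ne_of_lt hlt) hy0
      have h2 := hcirc (y - Pi.single ν 1) μ' ν (ne_of_lt hlt) (hy1 ν)
      have := abs_sub (u (y, μ') + u (y + Pi.single μ' 1, ν) - u (y + Pi.single ν 1, μ') - u (y, ν))
        (u (y - Pi.single ν 1, μ') + u (y - Pi.single ν 1 + Pi.single μ' 1, ν) -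
          u (y - Pi.single ν 1 + Pi.single ν 1, μ') - u (y - Pi.single ν 1, ν))
      nlinarith [abs_nonneg (u (y, μ') + u (y + Pi.single μ' 1, ν) - u (y + Pi.single ν 1, μ') - u (y, ν)),
        abs_nonneg (u (y - Pi.single ν 1, μ') + u (y - Pi.single ν 1 + Pi.single μ' 1, ν) -
          u (y - Pi.single ν 1 + Pi.single ν 1, μ') - u (y - Pi.single ν 1, ν))]
    · rw [if_neg hlt, abs_zero, zero_mul]; positivity
  have hB : ∀ ν : Fin 4, |(if ν < μ' then
        (u (y - Pi.single ν 1, ν) + u (y - Pi.single ν 1 + Pi.single ν 1, μ') -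
            u (y - Pi.single ν 1 + Pi.single μ' 1, ν) - u (y - Pi.single ν 1, μ')) -
          (u (y, ν) + u (y + Pi.single ν 1, μ') - u (y + Pi.single μ' 1, ν) - u (y, μ')) else 0)| * W ≤ 16 * C := by
    intro ν
    by_cases hlt : ν < μ'
    · rw [if_pos hlt]
      have h1 := hcirc (y - Pi.single ν 1) ν μ' (ne_of_lt hlt) (hy1 ν)
      have h2 := hcirc y ν μ' (ne_of_lt hlt) hy0
      have := abs_sub (u (y - Pi.single ν 1, ν) + u (y - Pi.single ν 1 + Pi.single ν 1, μ') -
            u (y - Pi.single ν 1 + Pi.single μ' 1, ν) - u (y - Pi.single ν 1, μ'))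
        (u (y, ν) + u (y + Pi.single ν 1, μ') - u (y + Pi.single μ' 1, ν) - u (y, μ'))
      nlinarith [abs_nonneg (u (y - Pi.single ν 1, ν) + u (y - Pi.single ν 1 + Pi.single ν 1, μ') -
            u (y - Pi.single ν 1 + Pi.single μ' 1, ν) - u (y - Pi.single ν 1, μ')),
        abs_nonneg (u (y, ν) + u (y + Pi.single ν 1, μ') - u (y + Pi.single μ' 1, ν) - u (y, μ'))]
    · rw [if_neg hlt, abs_zero, zero_mul]; positivity
  have hfin := abs_sum_add_sum_mul_le _ _ W (16 * C) hW0 hA hB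
  simp only [Fintype.card_fin] at hfin
  exact hfin.trans (by push_cast; linarith)

end RestBlock

end Summit.QuantumFields.YangMills.Theorems.AllWindowsColdBoxBoxHighLine

end
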